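import Literature.AlgebraicTopology.SingularHomology.CechDualityContinuity
import Literature.AlgebraicTopology.SingularHomology.CechDualityChartConvex
import Literature.AlgebraicTopology.SingularHomology.ExcisionTheorem
import HarnessLib

/-!
# The Čech cap product on classes from the whole space is the relative cap product

H. Miller, *Lectures on Algebraic Topology* (2020), §34 (before Def. 34.4): the cap product
`Ȟ^p(K) ⊗ Hₙ(X, X − K) → H_q(X, X − K)` is assembled from the actions of `H^p(U)` for the open
`U ⊇ K`, the action of `H^p(X)` itself being the ordinary relative cap product
`H^p(X) ⊗ Hₙ(X, X − K) → H_q(X, X − K)` ("the `H^*(X)` action factors through an action by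
`H^*(U)`"); and A. Hatcher, *Algebraic Topology* (2002), §3.3 p. 241: naturality of the cap product
(the projection formula `f⁎(f^*b ⌢ z) = b ⌢ f⁎z`), p. 240 (the relative cap product), §3.1
p. 197 (cochains `Hom(Cₚ(X), G)` "can be viewed as functions from singular simplices to `G`").

This file connects the tree's two cap products:

* `relativeSingularHomology.map_relCapProduct` — **the projection formula for maps of pairs**
  `f : (X, A) → (Y, B)`: `f⁎(f^*b ⌢ z) = b ⌢ f⁎z` for the relative cap product `relCapProduct`
  (`RelativeCapProduct.lean`), from the chain-level formula `ccapChain_map`;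
* `subsetCochains.theta` / `thetaInv` — **`H^p_X(X; 𝑹) ≅ H^p(X; R)`**: the cohomology of
  `Hom_R(C_X(univ), ULift R)` (cochains computed in the concrete complex `C(X)`,
  `SubsetCochains.lean`, the source of the Čech structure map `Cech.of univ`) is the singular
  cohomology of the tree (`singularCohomology R R X p`, function cochains), by
  `[ψ] ↦ [σ ↦ ψ(σ)]` (`SimplexSpan.toFun`) with inverse `[φ] ↦ [Σ r_σ σ ↦ Σ r_σ φ(σ)]`
  (`coext`); `theta_thetaInv`, `thetaInv_theta`, `theta_bijective`, `thetaInv_bijective`;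
* `cechCap_of_univ_thetaInv` — **the bridge**: for a closed `K`, `b ∈ H^p(X; R)` and
  `z ∈ Hₙ(X, X ∖ K; R)`, the Čech cap product (`cechCap`, `CechCapProduct.lean`) of the Čech class
  of `b` with `z` is the relative cap product `b ⌢ z`, read in the concrete model
  `H_q(X | K) = H_q(C(X)/C(X ∖ K))` through `relativeSingularHomology.concreteIso`:
  `cechCap hK h (concreteIso z) (Cech.of univ (thetaInv b)) = concreteIso (b ⌢ z)`.

Everything is proved; no named facts. Used by `…ExternalCollarDuality` to turn Čech duality
(Miller Thm. 37.1, `CechDuality`) for `K = W` in the external collar into Lefschetz duality.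

## References

* H. Miller, *Lectures on Algebraic Topology*, World Scientific 2020, §34, Def. 34.4. [Miller2020]
* A. Hatcher, *Algebraic Topology*, CUP 2002, §3.1 p. 197, §3.3 pp. 239–241. [HatcherAT2002]
-/

noncomputable section

-- as in `SingularChainsConcrete` / `LocalCapProduct`: chains of the concrete complex are `Finsupp`s
-- up to unfolding of semireducible definitions
set_option backward.isDefEq.respectTransparency false

open CategoryTheory Limits

universe u v

namespace Literature.AlgebraicTopology.SingularHomology

/-! ### The projection formula for maps of pairs -/

namespace relativeSingularHomology

variable {R : Type v} [CommRing R] {M : Type v} [AddCommGroup M] [Module R M]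
variable {X Y : Type u} [TopologicalSpace X] [TopologicalSpace Y] {p q n : ℕ}

/-- A map of pairs on a relative class given in the concrete model: `f⁎ [x] = [f♯ x]`. [folklore] -/
lemma map_concreteIso_inv_relCls {A : Set X} {B : Set Y} (f : C(X, Y)) (hf : Set.MapsTo f A B) (k : ℕ)
    (x : (csingularChainComplex R M X).X k)
    (hx : (csingularChainComplex R M X).d k ((ComplexShape.down ℕ).next k) x ∈
      chainsInSub R M X A ((ComplexShape.down ℕ).next k)) :
    map R M f hf k ((concreteIso R M X A k).inv ((chainsInSub R M X A).relCls x hx)) =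
      (concreteIso R M Y B k).inv ((chainsInSub R M Y B).relCls ((csingularChainComplex.map R M f).f k x)
        (Subcomplex.d_f_mem _ _ _ (chainsInSub_le_comap_map R M f hf) x hx)) := by
  rw [map_eq_concrete, ModuleCat.comp_apply, ModuleCat.comp_apply, Iso.inv_hom_id_apply,
    Subcomplex.homologyMap_quotMap_relCls]

/-- **The projection formula for maps of pairs** (naturality of the relative cap product): for
`f : (X, A) → (Y, B)`, `b ∈ Hᵖ(Y; R)` and `z ∈ Hₙ(X, A; M)`, `f⁎(f^*b ⌢ z) = b ⌢ f⁎z` in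
`H_q(Y, B; M)` (Hatcher 2002, §3.3 p. 241, "`f⁎(f^*(φ) ⌢ α) = φ ⌢ f⁎(α)` … The relative versions
also hold"). [cite: HatcherAT2002, §3.3 p. 241] -/
theorem map_relCapProduct {A : Set X} {B : Set Y} (f : C(X, Y)) (hf : Set.MapsTo f A B)
    (h : p + q = n) (b : singularCohomology R R Y p) (z : relativeSingularHomology R M X A n) :
    map R M f hf q (relCapProduct A h (singularCohomology.map R R f p b) z) =
      relCapProduct B h b (map R M f hf n z) := by
  induction b using singularCohomology_induction_on with
  | h a =>
  obtain ⟨x, hx, rfl⟩ : ∃ (x : (csingularChainComplex R M X).X n)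
      (hx : (csingularChainComplex R M X).d n ((ComplexShape.down ℕ).next n) x ∈
        chainsInSub R M X A ((ComplexShape.down ℕ).next n)),
      (concreteIso R M X A n).inv ((chainsInSub R M X A).relCls x hx) = z := by
    obtain ⟨x, hx, e⟩ := (chainsInSub R M X A).relCls_surjective ((concreteIso R M X A n).hom z)
    exact ⟨x, hx, by rw [e, Iso.hom_inv_id_apply]⟩
  rw [singularCohomology.map_π, relCapProduct_π_concreteIso_inv_relCls, map_concreteIso_inv_relCls,
    map_concreteIso_inv_relCls, relCapProduct_π_concreteIso_inv_relCls]
  congr 1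
  refine (chainsInSub R M Y B).relCls_congr ?_ _ _
  rw [singularCochainComplex.iCocycles_cocyclesMap]
  change (ccapChain M h ((singularCochainComplex.map R R f).f p (singularCochainComplex.iCocycles R R Y p a)) ≫
      (csingularChainComplex.map R M f).f q) x =
    ((csingularChainComplex.map R M f).f n ≫ ccapChain M h (singularCochainComplex.iCocycles R R Y p a)) x
  rw [ccapChain_map]

end relativeSingularHomology

/-! ### `H^p_X(X; 𝑹) ≅ H^p(X; R)`: cochains on `C_X(univ)` are function cochains -/

namespace subsetCochains

variable {R : Type v} [CommRing R] {X : Type u} [TopologicalSpace X]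

/-- Local notation: the coefficient object `R` of `ModuleCat.{max u v} R`. -/
local notation "𝑹" => SimplexSpan.coefR R

/-- Local notation: the simplex span `C(univ)` of all simplices. -/
local notation "𝒰" => (SimplexSpan.ofSet (R := R) (Set.univ : Set X))

/-- Every simplex belongs to the family of `C(univ)`. [folklore] -/
lemma mem_ofSet_univ {k : ℕ} (σ : SingularSimplex X k) : σ ∈ (𝒰).carrier k := Set.subset_univ _

/-- A cochain of `C_X(univ)` evaluated on an elementary chain is its function value, lifted. [folklore] -/
lemma apply_single_eq_up_toFun {k : ℕ} (ψ : (chainsInSub R R X Set.univ).toComplex.X k ⟶ 𝑹)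
    (σ : SingularSimplex X k) (hσ : Finsupp.single σ (1 : R) ∈ chainsInSub R R X Set.univ k) :
    ψ ⟨Finsupp.single σ 1, hσ⟩ = ULift.up ((𝒰).toFun ψ σ) := by
  rw [(𝒰).toFun_apply_of_mem ψ (mem_ofSet_univ σ)]
  rfl

/-- **The function cochain of a cocycle of `Hom(C_X(univ), 𝑹)` is a singular cocycle.** [folklore] -/
lemma d_toFun_eq_zero {p : ℕ} (ψ : (subsetCochains R 𝑹 (Set.univ : Set X)).X p)
    (hψ : (subsetCochains R 𝑹 (Set.univ : Set X)).d p (p + 1) ψ = 0) :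
    (singularCochainComplex R R X).d p (p + 1) ((𝒰).toFun ψ) = 0 := by
  funext τ
  rw [← (𝒰).toFun_d ψ (mem_ofSet_univ τ)]
  change (𝒰).toFun ((subsetCochains R 𝑹 (Set.univ : Set X)).d p (p + 1) ψ) τ = 0
  rw [hψ, SimplexSpan.toFun_zero]
  rfl

/-- `toFun (δψ) = δ (toFun ψ)` as function cochains. [folklore] -/
lemma toFun_d_eq {p : ℕ} (ψ : (subsetCochains R 𝑹 (Set.univ : Set X)).X p) :
    (𝒰).toFun ((subsetCochains R 𝑹 (Set.univ : Set X)).d p (p + 1) ψ) =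
      (singularCochainComplex R R X).d p (p + 1) ((𝒰).toFun ψ) := by
  funext τ
  exact (𝒰).toFun_d ψ (mem_ofSet_univ τ)

/-! #### From classes of `Hom(C_X(univ), 𝑹)` to singular cohomology classes -/

/-- The shape `up ℕ` of cochain complexes: `next p = p + 1`. [folklore] -/
lemma up_next (p : ℕ) : (ComplexShape.up ℕ).next p = p + 1 := (ComplexShape.up ℕ).next_eq' rfl

/-- The cocycle condition for the function cochain of a cocycle (kernel form). [folklore] -/
lemma d_toFun_of_mem_ker (p : ℕ) (ψ : LinearMap.ker ((subsetCochains R 𝑹 (Set.univ : Set X)).sc p).g.hom) :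
    (singularCochainComplex R R X).d p ((ComplexShape.up ℕ).next p) ((𝒰).toFun ψ.1) = 0 := by
  rw [up_next]
  refine d_toFun_eq_zero ψ.1 ?_
  rw [← SimplexSpan.symm_down_next p]
  exact LinearMap.mem_ker.mp ψ.2

/-- `[ψ] ↦ [toFun ψ]` on cocycles (kernel form). [folklore] -/
def thetaKer (p : ℕ) :
    LinearMap.ker ((subsetCochains R 𝑹 (Set.univ : Set X)).sc p).g.hom →ₗ[R] singularCohomology R R X p where
  toFun ψ := homologyCls (K := singularCochainComplex R R X) ((𝒰).toFun ψ.1) (d_toFun_of_mem_ker p ψ)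
  map_add' ψ ψ' := by
    refine (homologyCls_congr (by push_cast; exact (𝒰).toFun_add ψ.1 ψ'.1) _ ?_).trans
      (homologyCls_add _ _ (d_toFun_of_mem_ker p ψ) (d_toFun_of_mem_ker p ψ') _)
    rw [map_add, d_toFun_of_mem_ker, d_toFun_of_mem_ker, add_zero]
  map_smul' r ψ := by
    refine (homologyCls_congr (by push_cast; exact (𝒰).toFun_smul r ψ.1) _ ?_).trans
      (homologyCls_smul _ _ (d_toFun_of_mem_ker p ψ) _)
    rw [map_smul, d_toFun_of_mem_ker, smul_zero]

/-- `thetaKer` on a cocycle is the class of its function cochain. [folklore] -/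
lemma thetaKer_apply (p : ℕ) (ψ : LinearMap.ker ((subsetCochains R 𝑹 (Set.univ : Set X)).sc p).g.hom)
    (h : (singularCochainComplex R R X).d p ((ComplexShape.up ℕ).next p) ((𝒰).toFun ψ.1) = 0) :
    thetaKer p ψ = homologyCls ((𝒰).toFun ψ.1) h := rfl

/-- Classes of the form `[δw]` vanish: the homology class of a coboundary is zero. [folklore] -/
lemma homologyCls_d_eq_zero {K : HomologicalComplex (ModuleCat.{max u v} R) (ComplexShape.up ℕ)}
    (j : ℕ) (w : K.X j) (h : K.d (j + 1) ((ComplexShape.up ℕ).next (j + 1)) (K.d j (j + 1) w) = 0) :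
    homologyCls (K.d j (j + 1) w) h = 0 := by
  rw [homologyCls_eq_zero_iff]
  have hp : (ComplexShape.up ℕ).prev (j + 1) = j := CochainComplex.prev_nat_succ j
  refine ⟨(K.XIsoOfEq hp).inv w, ?_⟩
  rw [← ModuleCat.comp_apply, K.XIsoOfEq_inv_comp_d hp]

/-- `thetaKer` kills coboundaries. [folklore] -/
lemma thetaKer_d (p j : ℕ) (w : (subsetCochains R 𝑹 (Set.univ : Set X)).X j) :
    thetaKer p ⟨(subsetCochains R 𝑹 (Set.univ : Set X)).d j p w, d_mem_ker j w⟩ = 0 := by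
  by_cases hj : (ComplexShape.down ℕ).symm.Rel j p
  · obtain rfl : j + 1 = p := hj
    have e : (𝒰).toFun ((subsetCochains R 𝑹 (Set.univ : Set X)).d j (j + 1) w) =
        (singularCochainComplex R R X).d j (j + 1) ((𝒰).toFun w) := toFun_d_eq w
    have hd2 : (singularCochainComplex R R X).d (j + 1) ((ComplexShape.up ℕ).next (j + 1))
        ((singularCochainComplex R R X).d j (j + 1) ((𝒰).toFun w)) = 0 := by
      rw [← ModuleCat.comp_apply, HomologicalComplex.d_comp_d]
      rfl
    rw [thetaKer_apply _ _ (by rw [e]; exact hd2)]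
    exact (homologyCls_congr e _ hd2).trans (homologyCls_d_eq_zero j _ hd2)
  · have e : (⟨(subsetCochains R 𝑹 (Set.univ : Set X)).d j p w, d_mem_ker j w⟩ :
        LinearMap.ker ((subsetCochains R 𝑹 (Set.univ : Set X)).sc p).g.hom) = 0 := by
      apply Subtype.ext
      change (subsetCochains R 𝑹 (Set.univ : Set X)).d j p w = 0
      rw [(subsetCochains R 𝑹 (Set.univ : Set X)).shape j p hj]
      rfl
    rw [e, map_zero]

/-- **`Θ : H^p_X(X; 𝑹) → H^p(X; R)`, `[ψ] ↦ [σ ↦ ψ(σ)]`** — the cohomology of `Hom_R(C_X(univ), 𝑹)`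
mapped to the singular cohomology of function cochains (Hatcher 2002, §3.1 p. 197: cochains as
functions on singular simplices). [cite: HatcherAT2002, §3.1 p. 197] -/
def theta (p : ℕ) : (subsetCochains R 𝑹 (Set.univ : Set X)).homology p →ₗ[R] singularCohomology R R X p :=
  homologyDescKer (thetaKer p) fun w => thetaKer_d p _ w

/-- `Θ [ψ] = [toFun ψ]`. [folklore] -/
theorem theta_homologyCls (p : ℕ) (ψ : (subsetCochains R 𝑹 (Set.univ : Set X)).X p)
    (hψ : (subsetCochains R 𝑹 (Set.univ : Set X)).d p ((ComplexShape.down ℕ).symm.next p) ψ = 0)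
    (h : (singularCochainComplex R R X).d p ((ComplexShape.up ℕ).next p) ((𝒰).toFun ψ) = 0) :
    theta p (homologyCls ψ hψ) = homologyCls ((𝒰).toFun ψ) h := by
  rw [theta, homologyDescKer_homologyCls]
  rfl

/-- `Θ [ψ] = [a]` for every singular cocycle `a` whose underlying cochain is `toFun ψ`. [folklore] -/
theorem theta_homologyCls_eq_π (p : ℕ) (ψ : (subsetCochains R 𝑹 (Set.univ : Set X)).X p)
    (hψ : (subsetCochains R 𝑹 (Set.univ : Set X)).d p ((ComplexShape.down ℕ).symm.next p) ψ = 0)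
    (a : singularCochainComplex.cocycles R R X p)
    (ha : singularCochainComplex.iCocycles R R X p a = (𝒰).toFun ψ) :
    theta p (homologyCls ψ hψ) = singularCohomology.π R R X p a := by
  have h : (singularCochainComplex R R X).d p ((ComplexShape.up ℕ).next p) ((𝒰).toFun ψ) = 0 := by
    rw [← ha, ← ModuleCat.comp_apply, HomologicalComplex.iCycles_d]
    rfl
  rw [theta_homologyCls p ψ hψ h,
    homologyCls_eq_homologyπ_cyclesMk _ h ((ComplexShape.up ℕ).next p) rfl h]
  congr 1
  apply (ModuleCat.mono_iff_injective (singularCochainComplex.iCocycles R R X p)).mp inferInstance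
  rw [ha]
  exact (singularCochainComplex R R X).i_cyclesMk _ _ _ _

/-! #### The inverse: function cochains to cochains of `C_X(univ)` -/

/-- **The cochain of `Hom(C_X(univ)ₖ, 𝑹)` of a function cochain `φ`**: `Σ r_σ σ ↦ Σ r_σ φ(σ)`
(Hatcher 2002, §3.1 p. 197, `Hom(Cₖ(X), G)` vs functions on simplices). [cite: HatcherAT2002, §3.1 p. 197] -/
def coext {k : ℕ} (φ : SingularSimplex X k → R) : (subsetCochains R 𝑹 (Set.univ : Set X)).X k :=
  ModuleCat.ofHom ((ULift.moduleEquiv (R := R) (M := R)).symm.toLinearMap ∘ₗ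
    Finsupp.linearCombination R φ ∘ₗ (chainsIn R R X Set.univ k).subtype)

/-- The function cochain of `coext φ` is `φ`. [folklore] -/
@[simp] lemma toFun_coext {k : ℕ} (φ : SingularSimplex X k → R) : (𝒰).toFun (coext φ) = φ := by
  funext σ
  rw [(𝒰).toFun_apply_of_mem _ (mem_ofSet_univ σ)]
  change Finsupp.linearCombination R φ (Finsupp.single σ 1) = φ σ
  rw [Finsupp.linearCombination_single, one_smul]

/-- A cochain of `Hom(C_X(univ), 𝑹)` is determined by its function cochain. [folklore] -/
lemma eq_of_toFun_eq {k : ℕ} {ψ ψ' : (chainsInSub R R X Set.univ).toComplex.X k ⟶ 𝑹}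
    (h : (𝒰).toFun ψ = (𝒰).toFun ψ') : ψ = ψ' :=
  hom_ext_single ψ ψ' fun σ hσ => by
    rw [apply_single_eq_up_toFun, apply_single_eq_up_toFun, h]

/-- `coext (toFun ψ) = ψ`. [folklore] -/
@[simp] lemma coext_toFun {k : ℕ} (ψ : (chainsInSub R R X Set.univ).toComplex.X k ⟶ 𝑹) :
    coext ((𝒰).toFun ψ) = ψ :=
  eq_of_toFun_eq (toFun_coext _)

/-- `coext` is additive. [folklore] -/
lemma coext_add {k : ℕ} (φ φ' : SingularSimplex X k → R) : coext (φ + φ') = coext φ + coext φ' :=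
  eq_of_toFun_eq (by rw [toFun_coext, SimplexSpan.toFun_add, toFun_coext, toFun_coext])

/-- `coext` is homogeneous. [folklore] -/
lemma coext_smul {k : ℕ} (r : R) (φ : SingularSimplex X k → R) : coext (r • φ) = r • coext φ :=
  eq_of_toFun_eq (by rw [toFun_coext, SimplexSpan.toFun_smul, toFun_coext])

/-- `coext` commutes with the coboundaries: `coext (δφ) = δ (coext φ)`. [folklore] -/
lemma coext_d {k : ℕ} (φ : SingularSimplex X k → R) :
    coext ((singularCochainComplex R R X).d k (k + 1) φ) =
      (subsetCochains R 𝑹 (Set.univ : Set X)).d k (k + 1) (coext φ) :=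
  eq_of_toFun_eq (by rw [toFun_coext, toFun_d_eq, toFun_coext])

/-- The cocycle condition for `coext` of a singular cocycle (kernel form). [folklore] -/
lemma d_coext_of_mem_ker (p : ℕ) (φ : LinearMap.ker ((singularCochainComplex R R X).sc p).g.hom) :
    (subsetCochains R 𝑹 (Set.univ : Set X)).d p ((ComplexShape.down ℕ).symm.next p) (coext φ.1) = 0 := by
  rw [SimplexSpan.symm_down_next, ← coext_d]
  have h := LinearMap.mem_ker.mp φ.2
  change (singularCochainComplex R R X).d p ((ComplexShape.up ℕ).next p) φ.1 = 0 at h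
  rw [up_next] at h
  rw [h]
  exact eq_of_toFun_eq (by rw [toFun_coext, SimplexSpan.toFun_zero])

/-- `[φ] ↦ [coext φ]` on cocycles (kernel form). [folklore] -/
def thetaInvKer (p : ℕ) :
    LinearMap.ker ((singularCochainComplex R R X).sc p).g.hom →ₗ[R]
      (subsetCochains R 𝑹 (Set.univ : Set X)).homology p where
  toFun φ := homologyCls (K := subsetCochains R 𝑹 (Set.univ : Set X)) (coext φ.1) (d_coext_of_mem_ker p φ)
  map_add' φ φ' := by
    refine (homologyCls_congr (by push_cast; exact coext_add φ.1 φ'.1) _ ?_).trans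
      (homologyCls_add _ _ (d_coext_of_mem_ker p φ) (d_coext_of_mem_ker p φ') _)
    rw [map_add, d_coext_of_mem_ker, d_coext_of_mem_ker, add_zero]
  map_smul' r φ := by
    refine (homologyCls_congr (by push_cast; exact coext_smul r φ.1) _ ?_).trans
      (homologyCls_smul _ _ (d_coext_of_mem_ker p φ) _)
    rw [map_smul, d_coext_of_mem_ker, smul_zero]

/-- `thetaInvKer` on a cocycle is the class of `coext`. [folklore] -/
lemma thetaInvKer_apply (p : ℕ) (φ : LinearMap.ker ((singularCochainComplex R R X).sc p).g.hom)
    (h : (subsetCochains R 𝑹 (Set.univ : Set X)).d p ((ComplexShape.down ℕ).symm.next p) (coext φ.1) = 0) :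
    thetaInvKer p φ = homologyCls (coext φ.1) h := rfl

/-- Classes `[δw]` vanish in the cohomology of `Hom(C_X(univ), 𝑹)`. [folklore] -/
lemma homologyCls_d_eq_zero' {K : HomologicalComplex (ModuleCat.{max u v} R) (ComplexShape.down ℕ).symm}
    (j : ℕ) (w : K.X j) (h : K.d (j + 1) ((ComplexShape.down ℕ).symm.next (j + 1)) (K.d j (j + 1) w) = 0) :
    homologyCls (K.d j (j + 1) w) h = 0 := by
  rw [homologyCls_eq_zero_iff]
  have hp : (ComplexShape.down ℕ).symm.prev (j + 1) = j := SimplexSpan.symm_down_prev_succ j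
  refine ⟨(K.XIsoOfEq hp).inv w, ?_⟩
  rw [← ModuleCat.comp_apply, K.XIsoOfEq_inv_comp_d hp]

/-- `thetaInvKer` kills coboundaries. [folklore] -/
lemma thetaInvKer_d (p j : ℕ) (w : (singularCochainComplex R R X).X j) :
    thetaInvKer p ⟨(singularCochainComplex R R X).d j p w, d_mem_ker j w⟩ = 0 := by
  by_cases hj : (ComplexShape.up ℕ).Rel j p
  · obtain rfl : j + 1 = p := hj
    have hd2 : (subsetCochains R 𝑹 (Set.univ : Set X)).d (j + 1) ((ComplexShape.down ℕ).symm.next (j + 1))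
        ((subsetCochains R 𝑹 (Set.univ : Set X)).d j (j + 1) (coext w)) = 0 := by
      rw [← ModuleCat.comp_apply, HomologicalComplex.d_comp_d]
      rfl
    rw [thetaInvKer_apply _ _ (by rw [coext_d]; exact hd2)]
    exact (homologyCls_congr (coext_d w) _ hd2).trans (homologyCls_d_eq_zero' j _ hd2)
  · have e : (⟨(singularCochainComplex R R X).d j p w, d_mem_ker j w⟩ :
        LinearMap.ker ((singularCochainComplex R R X).sc p).g.hom) = 0 := by
      apply Subtype.ext
      change (singularCochainComplex R R X).d j p w = 0
      rw [(singularCochainComplex R R X).shape j p hj]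
      rfl
    rw [e, map_zero]

/-- **`Θ⁻¹ : H^p(X; R) → H^p_X(X; 𝑹)`, `[φ] ↦ [Σ r_σ σ ↦ Σ r_σ φ(σ)]`.** [cite: HatcherAT2002, §3.1 p. 197] -/
def thetaInv (p : ℕ) : singularCohomology R R X p →ₗ[R] (subsetCochains R 𝑹 (Set.univ : Set X)).homology p :=
  homologyDescKer (K := singularCochainComplex R R X) (thetaInvKer p) fun w => thetaInvKer_d p _ w

/-- `Θ⁻¹ [φ] = [coext φ]`. [folklore] -/
theorem thetaInv_homologyCls (p : ℕ) (φ : (singularCochainComplex R R X).X p)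
    (hφ : (singularCochainComplex R R X).d p ((ComplexShape.up ℕ).next p) φ = 0)
    (h : (subsetCochains R 𝑹 (Set.univ : Set X)).d p ((ComplexShape.down ℕ).symm.next p) (coext φ) = 0) :
    thetaInv p (homologyCls φ hφ) = homologyCls (coext φ) h :=
  homologyDescKer_homologyCls (K := singularCochainComplex R R X) (thetaInvKer p)
    (fun w => thetaInvKer_d p _ w) φ hφ

/-- `Θ⁻¹ [a] = [coext a]` for a singular cocycle `a`. [folklore] -/
theorem thetaInv_π (p : ℕ) (a : singularCochainComplex.cocycles R R X p)
    (h : (subsetCochains R 𝑹 (Set.univ : Set X)).d p ((ComplexShape.down ℕ).symm.next p)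
      (coext (singularCochainComplex.iCocycles R R X p a)) = 0) :
    thetaInv p (singularCohomology.π R R X p a) =
      homologyCls (coext (singularCochainComplex.iCocycles R R X p a)) h := by
  have ha : (singularCochainComplex R R X).d p ((ComplexShape.up ℕ).next p)
      (singularCochainComplex.iCocycles R R X p a) = 0 := by
    rw [← ModuleCat.comp_apply, HomologicalComplex.iCycles_d]
    rfl
  have e : singularCohomology.π R R X p a = homologyCls (singularCochainComplex.iCocycles R R X p a) ha := by
    rw [homologyCls_eq_homologyπ_cyclesMk _ ha ((ComplexShape.up ℕ).next p) rfl ha]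
    congr 1
    apply (ModuleCat.mono_iff_injective (singularCochainComplex.iCocycles R R X p)).mp inferInstance
    exact ((singularCochainComplex R R X).i_cyclesMk _ _ _ _).symm
  rw [e, thetaInv_homologyCls]

/-- A cocycle condition for `coext` of a singular cocycle. [folklore] -/
lemma d_coext_iCocycles (p : ℕ) (a : singularCochainComplex.cocycles R R X p) :
    (subsetCochains R 𝑹 (Set.univ : Set X)).d p ((ComplexShape.down ℕ).symm.next p)
      (coext (singularCochainComplex.iCocycles R R X p a)) = 0 := by
  rw [SimplexSpan.symm_down_next, ← coext_d]
  have : (singularCochainComplex R R X).d p (p + 1) (singularCochainComplex.iCocycles R R X p a) = 0 := by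
    rw [← up_next p, ← ModuleCat.comp_apply, HomologicalComplex.iCycles_d]
    rfl
  rw [this]
  exact eq_of_toFun_eq (by rw [toFun_coext, SimplexSpan.toFun_zero])

/-- **`Θ ∘ Θ⁻¹ = 𝟙`.** [folklore] -/
theorem theta_thetaInv (p : ℕ) (b : singularCohomology R R X p) : theta p (thetaInv p b) = b := by
  induction b using singularCohomology_induction_on with
  | h a =>
  rw [thetaInv_π p a (d_coext_iCocycles p a)]
  exact theta_homologyCls_eq_π p _ _ a (toFun_coext _).symm

/-- **`Θ⁻¹ ∘ Θ = 𝟙`.** [folklore] -/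
theorem thetaInv_theta (p : ℕ) (c : (subsetCochains R 𝑹 (Set.univ : Set X)).homology p) :
    thetaInv p (theta p c) = c := by
  obtain ⟨ψ, hψ, rfl⟩ := homologyCls_surjective c
  have h : (singularCochainComplex R R X).d p ((ComplexShape.up ℕ).next p) ((𝒰).toFun ψ) = 0 := by
    rw [up_next]
    refine d_toFun_eq_zero ψ ?_
    rw [← SimplexSpan.symm_down_next p]
    exact hψ
  rw [theta_homologyCls p ψ hψ h, thetaInv_homologyCls p _ h (by rw [coext_toFun]; exact hψ)]
  exact homologyCls_congr (coext_toFun ψ) _ _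

/-- `Θ` is bijective. [folklore] -/
theorem theta_bijective (p : ℕ) : Function.Bijective (theta (R := R) (X := X) p) :=
  Function.bijective_iff_has_inverse.mpr ⟨thetaInv p, thetaInv_theta p, theta_thetaInv p⟩

/-- `Θ⁻¹` is bijective. [folklore] -/
theorem thetaInv_bijective (p : ℕ) : Function.Bijective (thetaInv (R := R) (X := X) p) :=
  Function.bijective_iff_has_inverse.mpr ⟨theta p, theta_thetaInv p, thetaInv_theta p⟩

end subsetCochains

/-! ### The bridge: `cechCap` on classes from `X` is the relative cap product -/

section Bridge

variable {R : Type v} [CommRing R] {X : Type u} [TopologicalSpace X]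
variable {K : Set X} (hK : IsClosed K) {p q n : ℕ}

/-- Local notation: the coefficient object `R` of `ModuleCat.{max u v} R`. -/
local notation "𝑹" => SimplexSpan.coefR R

/-- Every chain is small for the one-set cover `{X}`. [folklore] -/
lemma mem_smallChains_univ {k : ℕ} (x : (csingularChainComplex R R X).X k) :
    x ∈ smallChains R R X (fun _ : Unit => (Set.univ : Set X)) k :=
  (mem_smallChains_iff R R _ x).mpr fun _ _ => ⟨(), Set.subset_univ _⟩

/-- **The Čech cap product of a class of `H^p_X(X)` is the relative cap product**: for a cocycle
`ψ` of `Hom(C_X(univ), 𝑹)`, a singular cocycle `a` with underlying cochain `toFun ψ`, and a relative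
cycle `x` of `(X, X ∖ K)`: `[ψ] ⌢ [x] = [x ⌢ a]`, i.e. `cechCap` of `Cech.of univ [ψ]` is
`relCapProduct (X ∖ K) [a]` read through `concreteIso` (Miller 2020, §34: the action of `H^p(X)` on
`H_*(X, X − K)` is the cap product; Hatcher 2002, p. 240). [cite: Miller2020, §34, Def. 34.4] -/
theorem cechCap_of_univ_homologyCls (h : p + q = n)
    (ψ : (subsetCochains R 𝑹 (Set.univ : Set X)).X p)
    (hψ : (subsetCochains R 𝑹 (Set.univ : Set X)).d p ((ComplexShape.down ℕ).symm.next p) ψ = 0)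
    (a : singularCochainComplex.cocycles R R X p)
    (ha : singularCochainComplex.iCocycles R R X p a = (SimplexSpan.ofSet (R := R) Set.univ).toFun ψ)
    (z : relativeSingularHomology R R X Kᶜ n) :
    cechCap hK h ((relativeSingularHomology.concreteIso R R X Kᶜ n).hom z)
        (Cech.of R 𝑹 (OpenNhd.univ K) (homologyCls ψ hψ)) =
      (relativeSingularHomology.concreteIso R R X Kᶜ q).hom
        (relCapProduct (M := R) Kᶜ h (singularCohomology.π R R X p a) z) := by
  -- represent `z` by a relative cycle of the concrete model
  obtain ⟨x, hx, rfl⟩ : ∃ (x : (csingularChainComplex R R X).X n)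
      (hx : (csingularChainComplex R R X).d n ((ComplexShape.down ℕ).next n) x ∈
        chainsInSub R R X Kᶜ ((ComplexShape.down ℕ).next n)),
      (relativeSingularHomology.concreteIso R R X Kᶜ n).inv ((chainsInSub R R X Kᶜ).relCls x hx) = z := by
    obtain ⟨x, hx, e⟩ := (chainsInSub R R X Kᶜ).relCls_surjective
      ((relativeSingularHomology.concreteIso R R X Kᶜ n).hom z)
    exact ⟨x, hx, by rw [e, Iso.hom_inv_id_apply]⟩
  have hψ' : IsCocycleOn (fun _ : Unit => (OpenNhd.univ K).carrier)
      ((SimplexSpan.ofSet (R := R) (OpenNhd.univ K).carrier).toFun ψ) :=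
    (SimplexSpan.ofSet (R := R) (OpenNhd.univ K).carrier).isCocycleOn_toFun (fun _ _ _ hσ => hσ) ψ
      (by rw [← SimplexSpan.symm_down_next p]; exact hψ)
  rw [Iso.inv_hom_id_apply, relCapProduct_π_concreteIso_inv_relCls, Iso.inv_hom_id_apply, cechCap_of,
    capOpen_homologyCls hK h _ (OpenNhd.univ K) ψ hψ hψ',
    clocalHomology.capLoc_eq_capSmall hK _ _ h hψ' x (mem_smallChains_univ x) hx rfl]
  unfold clocalHomology.capSmall
  refine (chainsInSub R R X Kᶜ).relCls_congr ?_ _ _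
  rw [ha]
  rfl

/-- **The bridge on classes**: for `b ∈ H^p(X; R)` and `z ∈ Hₙ(X, X ∖ K; R)`,
`cechCap hK h (concreteIso z) (Cech.of univ (Θ⁻¹ b)) = concreteIso (b ⌢ z)` (Miller 2020, §34;
Hatcher 2002, p. 240). [cite: Miller2020, §34, Def. 34.4] -/
theorem cechCap_of_univ_thetaInv (h : p + q = n) (b : singularCohomology R R X p)
    (z : relativeSingularHomology R R X Kᶜ n) :
    cechCap hK h ((relativeSingularHomology.concreteIso R R X Kᶜ n).hom z)
        (Cech.of R 𝑹 (OpenNhd.univ K) (subsetCochains.thetaInv p b)) =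
      (relativeSingularHomology.concreteIso R R X Kᶜ q).hom (relCapProduct (M := R) Kᶜ h b z) := by
  induction b using singularCohomology_induction_on with
  | h a =>
  rw [subsetCochains.thetaInv_π p a (subsetCochains.d_coext_iCocycles p a)]
  exact cechCap_of_univ_homologyCls hK h _ _ a (subsetCochains.toFun_coext _).symm z

end Bridge

end Literature.AlgebraicTopology.SingularHomology

end
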